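import Summits.BirchSwinnertonDyer.BirchSwinnertonDyer.Theorems.CyclotomicUntwistPSTamagawaThreeLaw
import Literature.NumberTheory.EllipticCurves.OggFormulaWildTypesKodairaProofs
import HarnessLib

/-!
# The Kraus signature, middle entry, on the whole cyclic wild cell at `3`: `v₃ c₆ = 3, 5, 6, 8` on the rows
# `v₃Δ_min = 4 (II), 6 (IV), 10 (IV*), 12 (II*)` — the parity input of the O6 SHAPE LAW at `v₃N = 4`

Cell `pub/bsd-wall` (D-0145 line `route-BirchSwinnertonDyer-CyclotomicUntwist`), seat `bsd-line-cycu-p2`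
(prover seat 2/3, gen 3), helper toward K1 `PSRankOneLowerHalfAtThree` (stmt-BirchSwinnertonDyer-21580) and
K2 `PSRankOneUpperHalfAtThree` (stmt-21581). THEOREMS ONLY (no definition, no named fact, no `sorry`); BSD is
not proved by this file and no crux is. Completes this seat's `padicValInt_c₆_eq_five_of_kodairaIV` /
`…_eq_six_of_kodairaIVstar` (`…PSTamagawaThreeLaw.lean`, p601441) by the two `η`-order-`3` rows:

* §1 (ring identities, `3` prime) `exists_c₆_eq_of_bShape_II`: `b₂ = 3β₂`, `b₄ = 3β₄`, `b₆ = 3β₆` with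
  `3 ∤ β₆`, `3⁴ ∣ Δ`, `3⁵ ∤ Δ` ⟹ `c₆ = 3³·κ`, `3 ∤ κ` (`4Δ = 3³·[−32β₄³ + 3(…)]` forces `3 ∣ β₄`, then
  `4Δ/3⁴ ≡ −β₂³β₆` forces `3 ∤ β₂`, and `c₆/27 ≡ −β₂³`); `exists_c₆_eq_of_bShape_IIstar`: `b₂ = 9β₂`,
  `b₄ = 81β₄`, `b₆ = 3⁵β₆` with `3 ∤ β₆`, `3¹² ∣ Δ` ⟹ `c₆ = 3⁸·κ`, `3 ∤ κ` (`4Δ/3¹¹ ≡ −β₂³β₆` forces `3 ∣ β₂`,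
  then `c₆/3⁸ ≡ −8β₆`).
* §2 (DVR with uniformiser `3`, `2` a unit) on Tate's normal forms
  (`LocalIndex.exists_smul_b_of_kodairaSymbolOfMinimal_eq_II / _eq_IIstar`): `c₆(I) = 3³·unit` for type `II`
  with `3⁴ ∥ Δ(I)`, `c₆(I) = 3⁸·unit` for type `II*` with `3¹² ∣ Δ(I)`.
* §3 (`ℚ`) **`padicValInt_c₆_eq_three_of_kodairaII`** (`K₃ = II`, `v₃Δ_min = 4`),
  **`padicValInt_c₆_eq_eight_of_kodairaIIstar`** (`K₃ = II*`, `v₃Δ_min = 12`), and the census spelling on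
  the cyclic cell **`padicValInt_c₆_of_classO6_of_even`**: `v = 4, 6, 10, 12 ↦ v₃c₆ = 3, 5, 6, 8`, whence
  **`odd_padicValInt_c₆_iff_of_classO6_of_even`**: `v₃ c₆` is ODD iff `v₃Δ_min ≤ 6` (Kodaira `II`/`IV`, the
  `ET` side of the V10 SHAPE LAW `WildThreeResidualShapeByKodaira` at `v₃N = 4`) and EVEN iff `v₃Δ_min ≥ 10`
  (`IV*`/`II*`, the `ORD` side) — Papadopoulos' Table II middle column on the cyclic rows, as a theorem `∀ W`.

References: I. Papadopoulos, J. Number Theory 44 (1993), Tableau II (p = 3) [Papadopoulos1993]; A. Kraus,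
Manuscripta Math. 69 (1990) [Kraus1990]; J. H. Silverman, *ATAEC* (1994) IV.9.4 Steps 3, 10 [SilvermanATAEC1994].
-/

open scoped Classical

open IsLocalRing IsDedekindDomain WeierstrassCurve Rat.HeightOneSpectrum
  Literature.NumberTheory.EllipticCurves Literature.NumberTheory.EllipticCurves.Rank1Residual
  Literature.NumberTheory.DiophantineGeometry Summit.BirchSwinnertonDyer.Rank1Residual.Additive

-- single-conjunct summit: `Summit.BirchSwinnertonDyer.BirchSwinnertonDyer.…` repeats the name by design
set_option linter.dupNamespace false
set_option autoImplicit false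

namespace Summit.BirchSwinnertonDyer.BirchSwinnertonDyer.Theorems.PSTamagawaThree

/-! ### §1 Ring identities on the `b`-shapes of types `II` and `II*` -/

section BShape

variable {R : Type*} [CommRing R] [IsDomain R]

omit [IsDomain R] in
/-- `4Δ = −b₂³b₆ + b₂²b₄² − 32b₄³ − 108b₆² + 36b₂b₄b₆`. [cite: SilvermanAEC2009, III.1] -/
theorem four_mul_Δ_eq (J : WeierstrassCurve R) :
    4 * J.Δ = -J.b₂ ^ 3 * J.b₆ + J.b₂ ^ 2 * J.b₄ ^ 2 - 32 * J.b₄ ^ 3 - 108 * J.b₆ ^ 2 +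
      36 * J.b₂ * J.b₄ * J.b₆ := by
  rw [WeierstrassCurve.Δ]
  linear_combination (-J.b₂ ^ 2) * J.b_relation

/-- **Type-`II` `b`-shape (`b₂, b₄, b₆ ∈ 3R`) with `3⁴ ∥ Δ`: `c₆ = 3³·κ`, `3 ∤ κ`** (`3 ∣ b₄/3` and
`3 ∤ b₂/3` are forced by `v(Δ) = 4`). [cite: Papadopoulos1993, Tableau II (p = 3)] -/
theorem exists_c₆_eq_of_bShape_II (h3 : Prime (3 : R)) (J : WeierstrassCurve R) {β₂ β₄ β₆ : R}
    (hb₂ : J.b₂ = 3 * β₂) (hb₄ : J.b₄ = 3 * β₄) (hb₆ : J.b₆ = 3 * β₆)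
    (h4 : (3 : R) ^ 4 ∣ J.Δ) (h5 : ¬ (3 : R) ^ 5 ∣ J.Δ) :
    ∃ κ : R, J.c₆ = 3 ^ 3 * κ ∧ ¬ (3 : R) ∣ κ := by
  have h30 : (3 : R) ≠ 0 := h3.ne_zero
  have h4Δ : 4 * J.Δ = 3 ^ 3 * (-32 * β₄ ^ 3 + 3 * (-β₂ ^ 3 * β₆ + β₂ ^ 2 * β₄ ^ 2) +
      9 * (-4 * β₆ ^ 2 + 4 * β₂ * β₄ * β₆)) := by
    rw [four_mul_Δ_eq, hb₂, hb₄, hb₆]; ring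
  -- `3 ∣ β₄`
  obtain ⟨q, hq⟩ := h4
  have hG : (3 : R) ∣ -32 * β₄ ^ 3 + 3 * (-β₂ ^ 3 * β₆ + β₂ ^ 2 * β₄ ^ 2) +
      9 * (-4 * β₆ ^ 2 + 4 * β₂ * β₄ * β₆) := by
    refine ⟨4 * q, mul_left_cancel₀ (pow_ne_zero 3 h30) ?_⟩
    rw [← h4Δ, hq]; ring
  have hβ₄ : (3 : R) ∣ β₄ := by
    apply h3.dvd_of_dvd_pow (n := 3)
    have e : β₄ ^ 3 = (-32 * β₄ ^ 3 + 3 * (-β₂ ^ 3 * β₆ + β₂ ^ 2 * β₄ ^ 2) +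
        9 * (-4 * β₆ ^ 2 + 4 * β₂ * β₄ * β₆)) +
        3 * (11 * β₄ ^ 3 - (-β₂ ^ 3 * β₆ + β₂ ^ 2 * β₄ ^ 2) - 3 * (-4 * β₆ ^ 2 + 4 * β₂ * β₄ * β₆)) := by
      ring
    rw [e]
    exact dvd_add hG (dvd_mul_right 3 _)
  obtain ⟨β₄', hβ₄'⟩ := hβ₄
  -- `3 ∤ β₂`
  have hβ₂ : ¬ (3 : R) ∣ β₂ := by
    intro hβ₂
    apply h5
    obtain ⟨γ, hγ⟩ := hβ₂
    have e : 4 * J.Δ = 3 ^ 5 * (-9 * γ ^ 3 * β₆ + 27 * γ ^ 2 * β₄' ^ 2 - 96 * β₄' ^ 3 - 4 * β₆ ^ 2 +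
        36 * γ * β₄' * β₆) := by
      rw [h4Δ, hβ₄', hγ]; ring
    -- `4` is invertible modulo `3`: `Δ = 4Δ − 3Δ`
    exact ⟨-9 * γ ^ 3 * β₆ + 27 * γ ^ 2 * β₄' ^ 2 - 96 * β₄' ^ 3 - 4 * β₆ ^ 2 + 36 * γ * β₄' * β₆ - q,
      by linear_combination e - 3 * hq⟩
  refine ⟨-β₂ ^ 3 + 36 * β₂ * β₄' - 24 * β₆, ?_, fun hκ ↦ hβ₂ ?_⟩
  · rw [WeierstrassCurve.c₆, hb₂, hb₄, hb₆, hβ₄']; ring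
  · apply h3.dvd_of_dvd_pow (n := 3)
    have e : β₂ ^ 3 = -(-β₂ ^ 3 + 36 * β₂ * β₄' - 24 * β₆) + 3 * (12 * β₂ * β₄' - 8 * β₆) := by ring
    rw [e]
    exact dvd_add (dvd_neg.mpr hκ) (dvd_mul_right 3 _)

/-- **Type-`II*` `b`-shape with `3¹² ∣ Δ`: `c₆ = 3⁸·κ`, `3 ∤ κ`.** [cite: Papadopoulos1993, Tableau II (p = 3)] -/
theorem exists_c₆_eq_of_bShape_IIstar (h3 : Prime (3 : R)) (J : WeierstrassCurve R) {β₂ β₄ β₆ : R}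
    (hb₂ : J.b₂ = 3 ^ 2 * β₂) (hb₄ : J.b₄ = 3 ^ 4 * β₄) (hb₆ : J.b₆ = 3 ^ 5 * β₆) (hβ₆ : ¬ (3 : R) ∣ β₆)
    (h12 : (3 : R) ^ 12 ∣ J.Δ) :
    ∃ κ : R, J.c₆ = 3 ^ 8 * κ ∧ ¬ (3 : R) ∣ κ := by
  have h30 : (3 : R) ≠ 0 := h3.ne_zero
  have h4Δ : 4 * J.Δ = 3 ^ 11 * (-β₂ ^ 3 * β₆ + 3 * (β₂ ^ 2 * β₄ ^ 2 - 32 * β₄ ^ 3) +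
      9 * (-4 * β₆ ^ 2 + 4 * β₂ * β₄ * β₆)) := by
    rw [four_mul_Δ_eq, hb₂, hb₄, hb₆]; ring
  obtain ⟨q, hq⟩ := h12
  have hG : (3 : R) ∣ -β₂ ^ 3 * β₆ + 3 * (β₂ ^ 2 * β₄ ^ 2 - 32 * β₄ ^ 3) +
      9 * (-4 * β₆ ^ 2 + 4 * β₂ * β₄ * β₆) := by
    refine ⟨4 * q, mul_left_cancel₀ (pow_ne_zero 11 h30) ?_⟩
    rw [← h4Δ, hq]; ring
  have hβ₂ : (3 : R) ∣ β₂ := by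
    have h : (3 : R) ∣ β₂ ^ 3 * β₆ := by
      have e : β₂ ^ 3 * β₆ = -(-β₂ ^ 3 * β₆ + 3 * (β₂ ^ 2 * β₄ ^ 2 - 32 * β₄ ^ 3) +
          9 * (-4 * β₆ ^ 2 + 4 * β₂ * β₄ * β₆)) +
          3 * ((β₂ ^ 2 * β₄ ^ 2 - 32 * β₄ ^ 3) + 3 * (-4 * β₆ ^ 2 + 4 * β₂ * β₄ * β₆)) := by ring
      rw [e]
      exact dvd_add (dvd_neg.mpr hG) (dvd_mul_right 3 _)
    rcases h3.dvd_or_dvd h with h' | h'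
    · exact h3.dvd_of_dvd_pow h'
    · exact absurd h' hβ₆
  obtain ⟨γ, hγ⟩ := hβ₂
  refine ⟨-3 * γ ^ 3 + 12 * γ * β₄ - 8 * β₆, ?_, fun hκ ↦ hβ₆ ?_⟩
  · rw [WeierstrassCurve.c₆, hb₂, hb₄, hb₆, hγ]; ring
  · have e : β₆ = (-3 * γ ^ 3 + 12 * γ * β₄ - 8 * β₆) + 3 * (3 * β₆ + γ ^ 3 - 4 * γ * β₄) := by ring
    rw [e]
    exact dvd_add hκ (dvd_mul_right 3 _)

end BShape

/-! ### §2 On Tate's normal forms over a DVR with uniformiser `3` -/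

section DVR

open Literature.NumberTheory.EllipticCurves.LocalIndex Literature.NumberTheory.DiophantineGeometry.TateAlgorithm

variable {R : Type*} [CommRing R] [IsDomain R] [IsDiscreteValuationRing R]

/-- `uniformizer R = 3·v` for a unit `v` when `3` is a uniformiser. [folklore] -/
theorem exists_uniformizer_eq_three_mul (h3 : Irreducible (3 : R)) :
    ∃ v : Rˣ, uniformizer R = 3 * v := by
  obtain ⟨v, hv⟩ := IsDiscreteValuationRing.associated_of_irreducible R h3 irreducible_uniformizer
  exact ⟨v, hv.symm⟩

/-- **Type `II` with `3⁴ ∥ Δ`: `c₆ = 3³·unit`** (Kraus signature `(2, 3, 4)`, middle entry).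
[cite: Papadopoulos1993, Tableau II (p = 3)] [cite: SilvermanATAEC1994, IV.9.4 Step 3] -/
theorem exists_c₆_eq_pow_three_mul_of_kodairaSymbolOfMinimal_eq_II [PerfectField (ResidueField R)]
    (h3 : Irreducible (3 : R)) (h2 : IsUnit (2 : R)) (I : WeierstrassCurve R)
    (hI : I.kodairaSymbolOfMinimal = .II) (h4 : (3 : R) ^ 4 ∣ I.Δ) (h5 : ¬ (3 : R) ^ 5 ∣ I.Δ) :
    ∃ κ : R, I.c₆ = 3 ^ 3 * κ ∧ ¬ (3 : R) ∣ κ := by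
  have h3p : Prime (3 : R) := h3.prime
  obtain ⟨D, hb₂, hb₄, u, -, hb₆⟩ := exists_smul_b_of_kodairaSymbolOfMinimal_eq_II h2 I hI
  obtain ⟨v, hv⟩ := exists_uniformizer_eq_three_mul h3
  rw [pow_one] at hb₂ hb₄ hb₆
  obtain ⟨β₂, hβ₂⟩ := (mem_maximalIdeal_iff_of_three h3 _).mp hb₂
  obtain ⟨β₄, hβ₄⟩ := (mem_maximalIdeal_iff_of_three h3 _).mp hb₄
  have hb₆' : (D • I).b₆ = 3 * ((v : R) * u) := by rw [hb₆, hv]; ring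
  have h4J : (3 : R) ^ 4 ∣ (D • I).Δ := by
    rw [WeierstrassCurve.variableChange_Δ]; exact Dvd.dvd.mul_left h4 _
  have h5J : ¬ (3 : R) ^ 5 ∣ (D • I).Δ := by
    rw [Δ_eq_units_pow_mul_Δ_smul I D] at h5
    intro h
    exact h5 (Dvd.dvd.mul_left h _)
  obtain ⟨κJ, hκJ, hκ3⟩ := exists_c₆_eq_of_bShape_II h3p (D • I) hβ₂ hβ₄ hb₆' h4J h5J
  refine ⟨(D.u : R) ^ 6 * κJ, by rw [c₆_eq_units_pow_mul_c₆_smul I D, hκJ]; ring, fun h ↦ ?_⟩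
  rcases h3p.dvd_or_dvd h with h' | h'
  · exact h3p.not_unit (isUnit_of_dvd_unit (h3p.dvd_of_dvd_pow h') (Units.isUnit _))
  · exact hκ3 h'

/-- **Type `II*` with `3¹² ∣ Δ`: `c₆ = 3⁸·unit`** (Kraus signature `(5, 8, 12)`, middle entry).
[cite: Papadopoulos1993, Tableau II (p = 3)] [cite: SilvermanATAEC1994, IV.9.4 Step 10] -/
theorem exists_c₆_eq_pow_eight_mul_of_kodairaSymbolOfMinimal_eq_IIstar [PerfectField (ResidueField R)]
    (h3 : Irreducible (3 : R)) (h2 : IsUnit (2 : R)) (I : WeierstrassCurve R)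
    (hI : I.kodairaSymbolOfMinimal = .IIstar) (h12 : (3 : R) ^ 12 ∣ I.Δ) :
    ∃ κ : R, I.c₆ = 3 ^ 8 * κ ∧ ¬ (3 : R) ∣ κ := by
  have h3p : Prime (3 : R) := h3.prime
  obtain ⟨D, hb₂, hb₄, u, hu, hb₆⟩ := exists_smul_b_of_kodairaSymbolOfMinimal_eq_IIstar h2 I hI
  obtain ⟨v, hv⟩ := exists_uniformizer_eq_three_mul h3
  obtain ⟨β₂, hβ₂⟩ := (mem_pow_maximalIdeal_iff_of_three h3 _ 2).mp hb₂
  obtain ⟨β₄, hβ₄⟩ := (mem_pow_maximalIdeal_iff_of_three h3 _ 4).mp hb₄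
  have hb₆' : (D • I).b₆ = 3 ^ 5 * ((v : R) ^ 5 * u) := by rw [hb₆, hv]; ring
  have hβ₆ : ¬ (3 : R) ∣ (v : R) ^ 5 * u := fun h ↦ by
    rcases h3p.dvd_or_dvd h with h' | h'
    · exact h3p.not_unit (isUnit_of_dvd_unit (h3p.dvd_of_dvd_pow h') v.isUnit)
    · exact h3p.not_unit (isUnit_of_dvd_unit h' hu)
  have h12J : (3 : R) ^ 12 ∣ (D • I).Δ := by
    rw [WeierstrassCurve.variableChange_Δ]; exact Dvd.dvd.mul_left h12 _
  obtain ⟨κJ, hκJ, hκ3⟩ := exists_c₆_eq_of_bShape_IIstar h3p (D • I) hβ₂ hβ₄ hb₆' hβ₆ h12J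
  refine ⟨(D.u : R) ^ 6 * κJ, by rw [c₆_eq_units_pow_mul_c₆_smul I D, hκJ]; ring, fun h ↦ ?_⟩
  rcases h3p.dvd_or_dvd h with h' | h'
  · exact h3p.not_unit (isUnit_of_dvd_unit (h3p.dvd_of_dvd_pow h') (Units.isUnit _))
  · exact hκ3 h'

end DVR

/-! ### §3 Over `ℚ`: `v₃ c₆ = 3` on the `II` rows (`v = 4`), `= 8` on the `II*` rows (`v = 12`) -/

section Rat

variable (W : WeierstrassCurve ℚ) [W.IsElliptic] [W.IsGloballyMinimal]

omit [W.IsElliptic] in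
/-- From `c₆(W_ℤ) = 3ᵏ·a⁶·κ₀` in `𝒪_{ℚ,(3)}` with `a` a unit and `3 ∤ κ₀`: `v₃ c₆(W_ℤ) = k`. [folklore] -/
theorem padicValInt_c₆_eq_of_local (k : ℕ) {a κ₀ : (placeOf 3).adicCompletionIntegers ℚ}
    (ha : IsUnit a) (hκ₀3 : ¬ (3 : (placeOf 3).adicCompletionIntegers ℚ) ∣ κ₀)
    (hn : (((integralModelInt W).c₆ : ℤ) : (placeOf 3).adicCompletionIntegers ℚ) = 3 ^ k * (a ^ 6 * κ₀)) :
    padicValInt 3 (integralModelInt W).c₆ = k := by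
  obtain ⟨-, h3⟩ := isUnit_two_and_irreducible_three_placeOf_three
  have h3p : Prime (3 : (placeOf 3).adicCompletionIntegers ℚ) := h3.prime
  obtain ⟨m, hm⟩ : (3 : ℤ) ^ k ∣ (integralModelInt W).c₆ := (three_pow_dvd_intCast_iff k _).mp ⟨_, hn⟩
  have hmO : ((m : ℤ) : (placeOf 3).adicCompletionIntegers ℚ) = a ^ 6 * κ₀ := by
    refine mul_left_cancel₀ (pow_ne_zero k h3.ne_zero) ?_
    rw [← hn, hm]; push_cast; ring
  refine padicValInt_three_eq_of_eq_pow_mul k hm fun h3m ↦ hκ₀3 ?_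
  have h' : (3 : (placeOf 3).adicCompletionIntegers ℚ) ∣ a ^ 6 * κ₀ := by
    rw [← hmO, ← pow_one (3 : (placeOf 3).adicCompletionIntegers ℚ)]
    exact (three_pow_dvd_intCast_iff 1 m).mpr (by simpa using h3m)
  rcases h3p.dvd_or_dvd h' with h'' | h''
  · exact absurd (isUnit_of_dvd_unit (h3p.dvd_of_dvd_pow h'') ha) h3p.not_unit
  · exact h''

/-- **`v₃ c₆ = 3` on the Kodaira-`II` rows with `v₃Δ_min = 4`** (signature `(2, 3, 4)`).
[cite: Papadopoulos1993, Tableau II (p = 3)] [cite: Kraus1990, Théorème (p = 3)] -/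
theorem padicValInt_c₆_eq_three_of_kodairaII (hK : W.kodairaSymbolAt (placeOf 3) = .II)
    (hv : padicValInt 3 W.minimalDiscriminantInt = 4) : padicValInt 3 (integralModelInt W).c₆ = 3 := by
  obtain ⟨h2, h3⟩ := isUnit_two_and_irreducible_three_placeOf_three
  haveI : PerfectField (ResidueField ((placeOf 3).adicCompletionIntegers ℚ)) := PerfectField.ofFinite
  have hI : (W.localMinimalIntegralModel (placeOf 3)).kodairaSymbolOfMinimal = .II := by
    rw [← kodairaSymbolAt_def]; exact hK
  have h4 : (3 : (placeOf 3).adicCompletionIntegers ℚ) ^ 4 ∣ (W.localMinimalIntegralModel (placeOf 3)).Δ :=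
    (three_pow_dvd_localMinimalIntegralModel_Δ_iff W 4).mpr hv.ge
  have h5 : ¬ (3 : (placeOf 3).adicCompletionIntegers ℚ) ^ 5 ∣ (W.localMinimalIntegralModel (placeOf 3)).Δ := by
    rw [three_pow_dvd_localMinimalIntegralModel_Δ_iff W 5, hv]; norm_num
  obtain ⟨κ₀, hκ₀, hκ₀3⟩ :=
    exists_c₆_eq_pow_three_mul_of_kodairaSymbolOfMinimal_eq_II h3 h2 _ hI h4 h5
  obtain ⟨a, ha, hc₆, -⟩ := exists_isUnit_c₆_Δ_eq_mul_localMinimalIntegralModel W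
  exact padicValInt_c₆_eq_of_local W 3 ha hκ₀3 (by rw [hc₆, hκ₀]; ring)

/-- **`v₃ c₆ = 8` on the Kodaira-`II*` rows with `v₃Δ_min = 12`** (signature `(5, 8, 12)`).
[cite: Papadopoulos1993, Tableau II (p = 3)] [cite: Kraus1990, Théorème (p = 3)] -/
theorem padicValInt_c₆_eq_eight_of_kodairaIIstar (hK : W.kodairaSymbolAt (placeOf 3) = .IIstar)
    (hv : padicValInt 3 W.minimalDiscriminantInt = 12) : padicValInt 3 (integralModelInt W).c₆ = 8 := by
  obtain ⟨h2, h3⟩ := isUnit_two_and_irreducible_three_placeOf_three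
  haveI : PerfectField (ResidueField ((placeOf 3).adicCompletionIntegers ℚ)) := PerfectField.ofFinite
  have hI : (W.localMinimalIntegralModel (placeOf 3)).kodairaSymbolOfMinimal = .IIstar := by
    rw [← kodairaSymbolAt_def]; exact hK
  have h12 : (3 : (placeOf 3).adicCompletionIntegers ℚ) ^ 12 ∣ (W.localMinimalIntegralModel (placeOf 3)).Δ :=
    (three_pow_dvd_localMinimalIntegralModel_Δ_iff W 12).mpr hv.ge
  obtain ⟨κ₀, hκ₀, hκ₀3⟩ :=
    exists_c₆_eq_pow_eight_mul_of_kodairaSymbolOfMinimal_eq_IIstar h3 h2 _ hI h12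
  obtain ⟨a, ha, hc₆, -⟩ := exists_isUnit_c₆_Δ_eq_mul_localMinimalIntegralModel W
  exact padicValInt_c₆_eq_of_local W 8 ha hκ₀3 (by rw [hc₆, hκ₀]; ring)

/-- **The middle Kraus entry on the whole cyclic wild cell** (`ClassO6 W 3`, `v₃Δ_min` even):
`v₃Δ_min = 4, 6, 10, 12 ↦ v₃ c₆ = 3, 5, 6, 8` (Papadopoulos' Table II on the four cyclic rows).
[cite: Papadopoulos1993, Tableau II (p = 3)] [cite: Kraus1990, Théorème (p = 3)] -/
theorem padicValInt_c₆_of_classO6_of_even (hO6 : ClassO6 W 3)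
    (hev : Even (padicValInt 3 W.minimalDiscriminantInt)) :
    (padicValInt 3 W.minimalDiscriminantInt = 4 ∧ padicValInt 3 (integralModelInt W).c₆ = 3) ∨
    (padicValInt 3 W.minimalDiscriminantInt = 6 ∧ padicValInt 3 (integralModelInt W).c₆ = 5) ∨
    (padicValInt 3 W.minimalDiscriminantInt = 10 ∧ padicValInt 3 (integralModelInt W).c₆ = 6) ∨
    (padicValInt 3 W.minimalDiscriminantInt = 12 ∧ padicValInt 3 (integralModelInt W).c₆ = 8) := by
  obtain ⟨-, hadd, hW⟩ := hO6
  rcases PSKodairaDictionary.kodairaSymbolAt_of_even W hadd hW hev with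
    ⟨hK, h⟩ | ⟨hK, h⟩ | ⟨hK, h⟩ | ⟨hK, h⟩
  · exact Or.inl ⟨h, padicValInt_c₆_eq_three_of_kodairaII W hK h⟩
  · exact Or.inr (Or.inl ⟨h, padicValInt_c₆_eq_five_of_kodairaIV W hK h⟩)
  · exact Or.inr (Or.inr (Or.inl ⟨h, padicValInt_c₆_eq_six_of_kodairaIVstar W hK h⟩))
  · exact Or.inr (Or.inr (Or.inr ⟨h, padicValInt_c₆_eq_eight_of_kodairaIIstar W hK h⟩))

/-- **Parity of `v₃ c₆` on the cyclic wild cell: ODD iff `v₃Δ_min ≤ 6` (Kodaira `II`/`IV`), EVEN iff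
`v₃Δ_min ≥ 10` (`IV*`/`II*`)** — the `c₆`-column of the V10 SHAPE LAW (`wildThreeResidualShapeByKodaira_iff_even_c₆`)
on the row `v₃N = 4`. [cite: Papadopoulos1993, Tableau II (p = 3)] -/
theorem odd_padicValInt_c₆_iff_of_classO6_of_even (hO6 : ClassO6 W 3)
    (hev : Even (padicValInt 3 W.minimalDiscriminantInt)) :
    Odd (padicValInt 3 (integralModelInt W).c₆) ↔ padicValInt 3 W.minimalDiscriminantInt ≤ 6 := by
  rcases padicValInt_c₆_of_classO6_of_even W hO6 hev with ⟨h, h'⟩ | ⟨h, h'⟩ | ⟨h, h'⟩ | ⟨h, h'⟩ <;>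
    rw [h, h'] <;> decide

end Rat

end Summit.BirchSwinnertonDyer.BirchSwinnertonDyer.Theorems.PSTamagawaThree
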